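import Literature.AlgebraicGeometry.HodgeTheory.AffineSpaceBundleCohomology
import Literature.AlgebraicGeometry.Motives.MonomialLinearSystemIncidence
import Literature.AlgebraicGeometry.HodgeTheory.FermatOddDegreeRestriction
import Literature.AlgebraicGeometry.Motives.ComplexPointsManifold
import Literature.AlgebraicGeometry.HodgeTheory.HodgeModelExistenceProofs
import HarnessLib

/-!
# The incidence variety of a base-point-free monomial linear system has no odd cohomology

Family `hodge`, layer `Literature/AlgebraicGeometry/HodgeTheory`; theorems only (no named fact; one
auxiliary definition, the projection `incidenceToProj`). For a base-point-free set `M` of degree-`d`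
monomials in `x₀, …, x_{n+1}` the incidence variety `W_M = V₊(F_M) ⊆ 𝔸^M × ℙⁿ⁺¹`
(`Motives/MonomialLinearSystemIncidence`) projects onto `ℙⁿ⁺¹`, and over the chart `D₊(xᵢ)` it is
the product `D₊(xᵢ) × 𝔸^{|M|-1}` (the defining equation is solved for the coefficient `a_{d eᵢ}`:
`MonomialLinearSystemIncidence.elimEquiv`). Hence `W_M(ℂ) → ℙⁿ⁺¹(ℂ)` is a bundle with fibre
`ℂ^{|M|-1}` and `Hᵏ(ℙⁿ⁺¹(ℂ); ℂ) ≅ Hᵏ(W_M(ℂ); ℂ)` (Dold 1963 Thm. 6.3 / the tree's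
`bijective_complexBetti_map_of_isZariskiLocallyAffineProduct`); in particular
**`Hᵏ(W_M(ℂ); ℂ) = 0` for odd `k`** (Hatcher Thm. 3.19 for `ℙⁿ⁺¹(ℂ)`).

* §1 `exists_iso_prod_affineSpace_of_mvPolynomial_chart` — **a polynomial chart in `r` variables is
  a product with `𝔸ʳ`**: the `r`-variable version of
  `AffineLineBundleCohomology.exists_iso_prod_affineSpace_of_polynomial_chart` (same proof, Mathlib
  `AffineSpace.homOfVector` / `AffineSpace.hom_ext`; Hartshorne II Prop. 2.3, Ex. 2.4);
  `isZariskiLocallyAffineProduct_of_mvPolynomial_charts`, `subsingleton_complexBetti_of_mvPolynomial_charts`.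
* §2 `incidenceToProj : W_M ⟶ ℙⁿ⁺¹_k` and its charts: `incidenceToProj_preimage_baseChart`, the
  ring isomorphism `Γ(W_M, q⁻¹D₊(xᵢ)) ≅ Γ(ℙⁿ⁺¹, D₊(xᵢ))[t₁, …, t_r]` compatible with `q^*`
  (`chartPolyEquiv`, `chartPolyEquiv_appLE`).
* §3 `subsingleton_complexBetti_incidenceOverM_of_odd` — the statement above (`k = ℂ`).

## References

* A. Dold, *Partitions of unity in the theory of fibrations*, Ann. of Math. 78 (1963), Thm. 6.3. [Dold1963]
* R. Hartshorne, *Algebraic Geometry* (1977), II Prop. 2.3, Ex. 2.4, Prop. 2.5. [Hartshorne1977]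
* A. Hatcher, *Algebraic Topology* (2002), Thm. 3.19. [HatcherAT2002]
* C. Voisin, *Hodge Theory and Complex Algebraic Geometry II* (2003), §2.1.1 eq. (2.2). [VoisinHodgeII2003]
-/

noncomputable section

open CategoryTheory CategoryTheory.Limits AlgebraicGeometry Function Set MonoidalCategory Opposite
open Literature.NumberTheory.Transcendental
open Literature.AlgebraicTopology.SingularHomology
open Literature.AlgebraicGeometry.Motives

universe u

namespace Literature.AlgebraicGeometry.HodgeTheory

/-! ### §1 Polynomial charts in `r` variables are products with `𝔸ʳ` -/

section PolynomialChart

variable {P Eo : Motives.SchemeOver ℂ}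

/-- **A polynomial chart in `r` variables is a product with affine `r`-space.** Let `ρ : E° → P` be
a morphism of `ℂ`-schemes, `V ⊆ P` an affine open with affine preimage `ρ⁻¹V`, and
`e : Γ(E°, ρ⁻¹V) ≅ Γ(P, V)[t₁, …, t_r]` a ring isomorphism under which `ρ^* : Γ(P, V) → Γ(E°, ρ⁻¹V)`
becomes the inclusion of constants. Then `ρ⁻¹V ≅ V ×_ℂ 𝔸ʳ_ℂ` over `V` (the morphism `(ρ|, t)`,
`t_j = e⁻¹(t_j)`, with inverse `Spec` of `e` followed by `t_j ↦` the coordinates; Hartshorne II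
Prop. 2.3 / Ex. 2.4, Mathlib `AffineSpace.homOfVector`). The case `r = 1` is
`exists_iso_prod_affineSpace_of_polynomial_chart`. [cite: Hartshorne1977, II Prop. 2.3 and Ex. 2.4] -/
theorem exists_iso_prod_affineSpace_of_mvPolynomial_chart (ρ : Eo ⟶ P) (V : P.left.Opens)
    (hV : IsAffineOpen V) (hO : IsAffineOpen (ρ.left ⁻¹ᵁ V)) (r : ℕ)
    (e : Γ(Eo.left, ρ.left ⁻¹ᵁ V) ≃+* MvPolynomial (Fin r) Γ(P.left, V))
    (he : ∀ s, e (ρ.left.appLE V (ρ.left ⁻¹ᵁ V) le_rfl s) = MvPolynomial.C s) :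
    ∃ ε : openSubschemeOver Eo (ρ.left ⁻¹ᵁ V) ≅ openSubschemeOver P V ⊗ affineSpaceOver (Fin r) ℂ,
      ε.hom ≫ CartesianMonoidalCategory.fst _ _ = restrictOverHom ρ V := by
  haveI : IsAffine (ρ.left ⁻¹ᵁ V : Scheme) := hO
  haveI : IsAffine (V : Scheme) := hV
  let OO : Motives.SchemeOver ℂ := openSubschemeOver Eo (ρ.left ⁻¹ᵁ V)
  let VV : Motives.SchemeOver ℂ := openSubschemeOver P V
  let AA : Motives.SchemeOver ℂ := affineSpaceOver (Fin r) ℂ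
  haveI : IsAffine OO.left := hO
  haveI : IsAffine VV.left := hV
  let g₁ : OO ⟶ VV := restrictOverHom ρ V
  -- the restriction of `ρ` on global sections
  have happ : g₁.left.appTop =
      V.topIso.hom ≫ ρ.left.appLE V (ρ.left ⁻¹ᵁ V) le_rfl ≫ (ρ.left ⁻¹ᵁ V).topIso.inv := by
    change (ρ.left ∣_ V).appTop = _
    rw [← Scheme.Hom.resLE_eq_morphismRestrict]
    exact Scheme.Hom.resLE_app_top ρ.left (le_rfl : ρ.left ⁻¹ᵁ V ≤ ρ.left ⁻¹ᵁ V)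
  have he' : ∀ a, e.symm (MvPolynomial.C a) = ρ.left.appLE V (ρ.left ⁻¹ᵁ V) le_rfl a := fun a ↦ by
    rw [← he, RingEquiv.symm_apply_apply]
  -- the coordinates `t_j = e⁻¹(t_j)` as global functions on `ρ⁻¹V`, and the forward morphism `(ρ|, t)`
  let t' : Fin r → Γ(OO.left, ⊤) := fun j ↦ (ρ.left ⁻¹ᵁ V).topIso.inv (e.symm (MvPolynomial.X j))
  let g₂ : OO ⟶ AA :=
    Over.homMk (AffineSpace.homOfVector OO.hom t') (AffineSpace.homOfVector_over _ _)
  let F : OO ⟶ VV ⊗ AA := CartesianMonoidalCategory.lift g₁ g₂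
  have hF₁ : F.left ≫ (CartesianMonoidalCategory.fst VV AA).left = g₁.left := by
    change (F ≫ CartesianMonoidalCategory.fst VV AA).left = _
    rw [CartesianMonoidalCategory.lift_fst]
  have hF₂ : F.left ≫ (CartesianMonoidalCategory.snd VV AA).left =
      AffineSpace.homOfVector OO.hom t' := by
    change (F ≫ CartesianMonoidalCategory.snd VV AA).left = _
    rw [CartesianMonoidalCategory.lift_snd]
    rfl
  -- the backward ring map `Γ(E°, ρ⁻¹V) ≅ Γ(P, V)[t] → Γ(V × 𝔸ʳ)`
  let cV : Γ(P.left, V) →+* Γ((VV ⊗ AA).left, ⊤) :=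
    ((CartesianMonoidalCategory.fst VV AA).left.appTop).hom.comp V.topIso.inv.hom
  let xA : Fin r → Γ((VV ⊗ AA).left, ⊤) := fun j ↦
    (CartesianMonoidalCategory.snd VV AA).left.appTop (AffineSpace.coord (Spec (.of ℂ)) j)
  let ψ : MvPolynomial (Fin r) Γ(P.left, V) →+* Γ((VV ⊗ AA).left, ⊤) := MvPolynomial.eval₂Hom cV xA
  let φ : Γ(Eo.left, ρ.left ⁻¹ᵁ V) →+* Γ((VV ⊗ AA).left, ⊤) := ψ.comp e.toRingHom
  have hφC : ∀ a, φ (e.symm (MvPolynomial.C a)) =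
      (CartesianMonoidalCategory.fst VV AA).left.appTop (V.topIso.inv a) := by
    intro a
    change ψ (e (e.symm (MvPolynomial.C a))) = _
    rw [RingEquiv.apply_symm_apply]
    change MvPolynomial.eval₂ cV xA (MvPolynomial.C a) = _
    rw [MvPolynomial.eval₂_C]
    rfl
  have hφX : ∀ j, φ (e.symm (MvPolynomial.X j)) = xA j := fun j ↦ by
    change ψ (e (e.symm (MvPolynomial.X j))) = _
    rw [RingEquiv.apply_symm_apply]
    change MvPolynomial.eval₂ cV xA (MvPolynomial.X j) = _
    rw [MvPolynomial.eval₂_X]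
  -- the backward morphism `V × 𝔸ʳ → Spec Γ(E°, ρ⁻¹V) ≅ ρ⁻¹V`
  let G₀ : (VV ⊗ AA).left ⟶ Spec Γ(Eo.left, ρ.left ⁻¹ᵁ V) :=
    ΓSpec.adjunction.homEquiv (VV ⊗ AA).left (op Γ(Eo.left, ρ.left ⁻¹ᵁ V)) (CommRingCat.ofHom φ).op
  have hG₀ : (Scheme.ΓSpecIso Γ(Eo.left, ρ.left ⁻¹ᵁ V)).inv ≫ G₀.appTop = CommRingCat.ofHom φ :=
    ΓSpecIso_inv_ΓSpec_adjunction_homEquiv (CommRingCat.ofHom φ)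
  let G : (VV ⊗ AA).left ⟶ OO.left := G₀ ≫ hO.isoSpec.inv
  have hGapp : G.appTop = (ρ.left ⁻¹ᵁ V).topIso.hom ≫ CommRingCat.ofHom φ := by
    change (G₀ ≫ hO.isoSpec.inv).appTop = _
    rw [Scheme.Hom.comp_appTop, IsAffineOpen.isoSpec_inv_appTop, Category.assoc, hG₀]
  have hGapp' : ∀ s, G.appTop s = φ ((ρ.left ⁻¹ᵁ V).topIso.hom s) := fun s ↦ by
    rw [hGapp]
    rfl
  have htop : ∀ s, (ρ.left ⁻¹ᵁ V).topIso.hom ((ρ.left ⁻¹ᵁ V).topIso.inv s) = s := fun s ↦ by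
    rw [← CategoryTheory.comp_apply, Iso.inv_hom_id, CategoryTheory.id_apply]
  have htopV : ∀ s, V.topIso.inv (V.topIso.hom s) = s := fun s ↦ by
    rw [← CategoryTheory.comp_apply, Iso.hom_inv_id, CategoryTheory.id_apply]
  -- `G ≫ ρ| = pr₁`
  have hGfst : G ≫ g₁.left = (CartesianMonoidalCategory.fst VV AA).left := by
    refine ext_of_isAffine (CommRingCat.hom_ext (RingHom.ext fun s ↦ ?_))
    rw [Scheme.Hom.comp_appTop, happ]
    change G.appTop ((ρ.left ⁻¹ᵁ V).topIso.inv
      (ρ.left.appLE V (ρ.left ⁻¹ᵁ V) le_rfl (V.topIso.hom s))) = _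
    rw [hGapp', ← he', htop, hφC, htopV]
  have hOOhom : OO.hom = g₁.left ≫ VV.hom := (Over.w (restrictOverHom ρ V)).symm
  have hGover : G ≫ OO.hom = (VV ⊗ AA).hom := by
    rw [hOOhom, ← Category.assoc, hGfst]
    exact Over.w (CartesianMonoidalCategory.fst VV AA)
  let GOver : VV ⊗ AA ⟶ OO := Over.homMk G hGover
  -- `F ≫ G = 𝟙`: compare the ring endomorphisms of `Γ(ρ⁻¹V) ≅ Γ(P, V)[t]` on `C a` and on `t_j`
  have hFG : F ≫ GOver = 𝟙 OO := by
    ext1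
    change F.left ≫ G = 𝟙 OO.left
    refine ext_of_isAffine ?_
    rw [Scheme.Hom.comp_appTop, Scheme.Hom.id_appTop]
    have key : F.left.appTop.hom.comp (G.appTop.hom.comp
        ((ρ.left ⁻¹ᵁ V).topIso.inv.hom.comp e.symm.toRingHom)) =
        (ρ.left ⁻¹ᵁ V).topIso.inv.hom.comp e.symm.toRingHom := by
      refine MvPolynomial.ringHom_ext (fun a ↦ ?_) fun j ↦ ?_
      · change F.left.appTop (G.appTop ((ρ.left ⁻¹ᵁ V).topIso.inv (e.symm (MvPolynomial.C a)))) =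
          (ρ.left ⁻¹ᵁ V).topIso.inv (e.symm (MvPolynomial.C a))
        rw [hGapp', htop, hφC, ← CategoryTheory.comp_apply, ← Scheme.Hom.comp_appTop, hF₁, happ,
          he']
        change (ρ.left ⁻¹ᵁ V).topIso.inv (ρ.left.appLE V (ρ.left ⁻¹ᵁ V) le_rfl
          (V.topIso.hom (V.topIso.inv a))) = _
        rw [← CategoryTheory.comp_apply V.topIso.inv, Iso.inv_hom_id, CategoryTheory.id_apply]
      · change F.left.appTop (G.appTop ((ρ.left ⁻¹ᵁ V).topIso.inv (e.symm (MvPolynomial.X j)))) =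
          (ρ.left ⁻¹ᵁ V).topIso.inv (e.symm (MvPolynomial.X j))
        rw [hGapp', htop, hφX]
        change F.left.appTop ((CartesianMonoidalCategory.snd VV AA).left.appTop _) = t' j
        rw [← CategoryTheory.comp_apply, ← Scheme.Hom.comp_appTop, hF₂]
        exact AffineSpace.homOfVector_appTop_coord (f := OO.hom) (v := t') j
    refine CommRingCat.hom_ext (RingHom.ext fun s ↦ ?_)
    have hs : s = (ρ.left ⁻¹ᵁ V).topIso.inv (e.symm (e ((ρ.left ⁻¹ᵁ V).topIso.hom s))) := by
      rw [RingEquiv.symm_apply_apply, ← CategoryTheory.comp_apply, Iso.hom_inv_id,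
        CategoryTheory.id_apply]
    change F.left.appTop (G.appTop s) = s
    conv_lhs => rw [hs]
    conv_rhs => rw [hs]
    exact congrArg (fun f : MvPolynomial (Fin r) Γ(P.left, V) →+* Γ(OO.left, ⊤) ↦
      f (e ((ρ.left ⁻¹ᵁ V).topIso.hom s))) key
  -- `G ≫ F = 𝟙`: test against the two projections
  have hGF : GOver ≫ F = 𝟙 (VV ⊗ AA) := by
    refine CartesianMonoidalCategory.hom_ext _ _ ?_ ?_
    · rw [Category.assoc, CartesianMonoidalCategory.lift_fst, Category.id_comp]
      ext1
      exact hGfst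
    · rw [Category.assoc, CartesianMonoidalCategory.lift_snd, Category.id_comp]
      ext1
      change G ≫ AffineSpace.homOfVector OO.hom t' = (CartesianMonoidalCategory.snd VV AA).left
      refine AffineSpace.hom_ext ?_ fun j ↦ ?_
      · rw [Category.assoc, AffineSpace.homOfVector_over, hGover]
        exact (Over.w (CartesianMonoidalCategory.snd VV AA)).symm
      · rw [Scheme.Hom.comp_appTop, CategoryTheory.comp_apply, AffineSpace.homOfVector_appTop_coord,
          hGapp', htop, hφX]
        rfl
  exact ⟨⟨F, GOver, hFG, hGF⟩, CartesianMonoidalCategory.lift_fst g₁ g₂⟩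

/-- **Polynomial charts make `ρ` Zariski-locally a product with `𝔸ʳ`** (`IsZariskiLocallyAffineProduct`):
a cover of `P` by affine opens `V_a` with affine preimages and polynomial charts
`Γ(E°, ρ⁻¹V_a) ≅ Γ(P, V_a)[t₁, …, t_r]` compatible with `ρ^*`. [cite: Hartshorne1977, II Prop. 2.3 and Ex. 2.4] -/
theorem isZariskiLocallyAffineProduct_of_mvPolynomial_charts (ρ : Eo ⟶ P) (r : ℕ) {α : Type*}
    (V : α → P.left.Opens) (hcov : ∀ x : P.left, ∃ a, x ∈ V a) (hV : ∀ a, IsAffineOpen (V a))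
    (hO : ∀ a, IsAffineOpen (ρ.left ⁻¹ᵁ V a))
    (e : ∀ a, Γ(Eo.left, ρ.left ⁻¹ᵁ V a) ≃+* MvPolynomial (Fin r) Γ(P.left, V a))
    (he : ∀ a s, e a (ρ.left.appLE (V a) (ρ.left ⁻¹ᵁ V a) le_rfl s) = MvPolynomial.C s) :
    IsZariskiLocallyAffineProduct ρ r := by
  intro x
  obtain ⟨a, ha⟩ := hcov x
  obtain ⟨ε, hε⟩ := exists_iso_prod_affineSpace_of_mvPolynomial_chart ρ (V a) (hV a) (hO a) r (e a) (he a)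
  refine ⟨openSubschemeOver P (V a), openSubschemeOver Eo (ρ.left ⁻¹ᵁ V a), openSubschemeOverι P (V a),
    openSubschemeOverι Eo (ρ.left ⁻¹ᵁ V a), isOpenImmersion_openSubschemeOverι_left P (V a),
    isOpenImmersion_openSubschemeOverι_left Eo _, ε, ?_, ?_, ?_⟩
  · change x ∈ Set.range (V a).ι.base
    rw [Scheme.Opens.range_ι]
    exact ha
  · change ρ.left.base ⁻¹' Set.range (V a).ι.base ⊆ Set.range (ρ.left ⁻¹ᵁ V a).ι.base
    rw [Scheme.Opens.range_ι, Scheme.Opens.range_ι]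
    exact subset_rfl
  · rw [← Category.assoc, hε, restrictOverHom_comp_openSubschemeOverι]

/-- **Cohomology of a scheme with polynomial charts over `P`**: if `P(ℂ)` is Hausdorff paracompact,
`ρ^* : Hᵏ(P(ℂ); ℂ) → Hᵏ(E°(ℂ); ℂ)` is bijective; in particular `Hᵏ(E°(ℂ); ℂ) = 0` whenever
`Hᵏ(P(ℂ); ℂ) = 0` (Dold 1963, Thm. 6.3, via `bijective_complexBetti_map_of_isZariskiLocallyAffineProduct`).
[cite: Dold1963, Thm. 6.3] -/
theorem subsingleton_complexBetti_of_mvPolynomial_charts [T2Space (ComplexPoints P)]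
    [ParacompactSpace (ComplexPoints P)] (ρ : Eo ⟶ P) (r : ℕ) {α : Type*}
    (V : α → P.left.Opens) (hcov : ∀ x : P.left, ∃ a, x ∈ V a) (hV : ∀ a, IsAffineOpen (V a))
    (hO : ∀ a, IsAffineOpen (ρ.left ⁻¹ᵁ V a))
    (e : ∀ a, Γ(Eo.left, ρ.left ⁻¹ᵁ V a) ≃+* MvPolynomial (Fin r) Γ(P.left, V a))
    (he : ∀ a s, e a (ρ.left.appLE (V a) (ρ.left ⁻¹ᵁ V a) le_rfl s) = MvPolynomial.C s)
    (k : ℕ) [Subsingleton (complexBetti P k)] : Subsingleton (complexBetti Eo k) := by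
  have hbij := bijective_complexBetti_map_of_isZariskiLocallyAffineProduct
    (isZariskiLocallyAffineProduct_of_mvPolynomial_charts ρ r V hcov hV hO e he) k
  refine ⟨fun a b ↦ ?_⟩
  obtain ⟨a', rfl⟩ := hbij.2 a
  obtain ⟨b', rfl⟩ := hbij.2 b
  rw [Subsingleton.elim a' b']

end PolynomialChart

/-! ### §2 The projection `W_M → ℙⁿ⁺¹_k` and its polynomial charts -/

section IncidenceCharts

open MvPolynomial HomogeneousLocalization
open Literature.AlgebraicGeometry.Motives.UniversalHypersurface

variable (k : Type u) [Field k] (n d : ℕ) (M : Set (DegIndex n d)) (hM : IsBasePointFree n d M)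
  (i : Fin (n + 2))

attribute [local instance] MvPolynomial.gradedAlgebra ProjBaseChange.algebraBase
  ProjBaseChange.isScalarTower_localization

/-- graded pieces of `R[x₀, …, x_{n+1}]` -/
local notation "𝒜" R => MvPolynomial.homogeneousSubmodule (Fin (n + 2)) R

/-- The base-change morphism `ℙⁿ⁺¹_{R_M} → ℙⁿ⁺¹_k` (Mathlib `Proj.map` of `k[x] → R_M[x]`).
[cite: Hartshorne1977, II Prop. 2.5] -/
def projToBaseField : projSp n (CoeffRingM k n d M) ⟶ projSp n k :=
  Proj.map (ProjBaseChangeRing.mapGraded k (CoeffRingM k n d M) (Fin (n + 2)))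
    (ProjBaseChangeRing.irrelevant_le_map k (CoeffRingM k n d M) (Fin (n + 2)))

/-- `ℙⁿ⁺¹_{R_M} → ℙⁿ⁺¹_k → Spec k` is `ℙⁿ⁺¹_{R_M} → Spec R_M → Spec k`
(`ProjBaseChangeRing.isPullback_projMap'`). [cite: Hartshorne1977, II Prop. 2.5] -/
@[reassoc]
theorem projToBaseField_comp_projSpToSpec :
    projToBaseField k n d M ≫ projSpToSpec n k =
      projSpToSpec n (CoeffRingM k n d M) ≫ specMToSpec k n d M :=
  (ProjBaseChangeRing.isPullback_projMap' k (CoeffRingM k n d M)).w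

/-- **The projection `q : W_M ⟶ ℙⁿ⁺¹_k`** of `k`-schemes, `(f, x) ↦ x`. [cite: VoisinHodgeII2003, §2.1.1 eq. (2.2)] -/
def incidenceToProj : incidenceOverM k n d M ⟶ projectiveSpace (n + 1) k :=
  Over.homMk (incidenceιM k n d M ≫ projToBaseField k n d M) (by
    change (incidenceιM k n d M ≫ projToBaseField k n d M) ≫ projSpToSpec n k =
      incidenceToSpecM k n d M ≫ specMToSpec k n d M
    rw [Category.assoc, projToBaseField_comp_projSpToSpec]
    exact (Category.assoc _ _ _).symm)

/-- Its underlying morphism (`rfl`). [cite: VoisinHodgeII2003, §2.1.1 eq. (2.2)] -/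
theorem incidenceToProj_left :
    (incidenceToProj k n d M).left = incidenceιM k n d M ≫ projToBaseField k n d M := rfl

/-- The chart `D₊(xᵢ) ⊆ ℙⁿ⁺¹_k`. [cite: Hartshorne1977, II Prop. 2.5] -/
def baseChart : (projectiveSpace (n + 1) k).left.Opens := Proj.basicOpen (𝒜 k) (X i)

/-- `D₊(xᵢ)` is affine. [cite: Hartshorne1977, II Prop. 2.5] -/
theorem isAffineOpen_baseChart : IsAffineOpen (baseChart k n i) :=
  Proj.isAffineOpen_basicOpen _ (X i) (ProjectiveSpace.X_mem i) one_pos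

/-- The charts `D₊(xᵢ)` cover `ℙⁿ⁺¹_k`. [cite: Hartshorne1977, II Prop. 2.5] -/
theorem exists_mem_baseChart (p : (projectiveSpace (n + 1) k).left) : ∃ i, p ∈ baseChart k n i := by
  by_contra! H
  refine p.not_irrelevant_le fun a ha => ?_
  have H' : ∀ i : Fin (n + 2), (X i : MvPolynomial (Fin (n + 2)) k) ∈ p.asHomogeneousIdeal :=
    fun i => not_not.mp (H i)
  exact Ideal.span_le.mpr (Set.range_subset_iff.mpr H')
    (ProjBaseChangeRing.irrelevant_le_span_X k ha)

/-- The base-changed variable `xᵢ ∈ R_M[x]` (literally `mapGraded (X i)`; equal to `X i`). [cite: Hartshorne1977, II Prop. 2.5] -/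
abbrev mapX : MvPolynomial (Fin (n + 2)) (CoeffRingM k n d M) :=
  ProjBaseChangeRing.mapGraded k (CoeffRingM k n d M) (Fin (n + 2)) (X i)

/-- `mapGraded (X i) = X i`. [cite: Hartshorne1977, II Prop. 2.5] -/
theorem mapX_eq : mapX k n d M i = X i := ProjBaseChangeRing.mapGraded_X k (CoeffRingM k n d M) i

/-- `mapGraded (X i)` has degree one. [cite: Hartshorne1977, II Prop. 2.5] -/
theorem mapX_mem : mapX k n d M i ∈ (𝒜 (CoeffRingM k n d M)) 1 :=
  (ProjBaseChangeRing.mapGraded k (CoeffRingM k n d M) (Fin (n + 2))).map_mem (ProjectiveSpace.X_mem i)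

/-- The preimage chart `D₊(xᵢ) ⊆ ℙⁿ⁺¹_{R_M}` written with the base-changed variable (so that it is
literally the preimage of `D₊(xᵢ) ⊆ ℙⁿ⁺¹_k`). [cite: Hartshorne1977, II Prop. 2.5] -/
abbrev mapChart : (projSp n (CoeffRingM k n d M)).affineOpens :=
  ProjSubscheme.affineBasicOpen (𝒜 (CoeffRingM k n d M)) (mapX k n d M i) (mapX_mem k n d M i) one_pos

/-- It is the chart `coordChartOpenM i` of `MonomialLinearSystemIncidence`. [cite: Hartshorne1977, II Prop. 2.5] -/
theorem mapChart_eq : mapChart k n d M i = coordChartOpenM k n d M i :=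
  Subtype.ext (congrArg (Proj.basicOpen (𝒜 (CoeffRingM k n d M))) (mapX_eq k n d M i))

/-- The preimage of `D₊(xᵢ)` under `q` is `W_M ∩ D₊(xᵢ)` (`rfl`). [cite: Hartshorne1977, II Prop. 2.5] -/
theorem incidenceToProj_preimage_baseChart :
    (incidenceToProj k n d M).left ⁻¹ᵁ baseChart k n i =
      incidenceιM k n d M ⁻¹ᵁ (mapChart k n d M i : (projSp n (CoeffRingM k n d M)).Opens) :=
  rfl

/-- `W_M ∩ D₊(xᵢ)` is affine (the image of the affine piece of the closed subscheme). [cite: Hartshorne1977, II Prop. 5.9] -/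
theorem isAffineOpen_incidenceToProj_preimage_baseChart :
    IsAffineOpen ((incidenceToProj k n d M).left ⁻¹ᵁ baseChart k n i) := by
  rw [incidenceToProj_preimage_baseChart, ← ProjSubscheme.opensRange_subschemePiece]
  exact isAffineOpen_opensRange
    (ProjSubscheme.subschemePiece (idealSheafM k n d M) (mapChart k n d M i))

/-! #### Transport along `mapGraded (X i) = X i` -/

/-- The homogeneous localization `(R_M[x]_g)₀` (an abbreviation fixing the grading). [cite: Hartshorne1977, II Prop. 2.5] -/
abbrev AwayM (g : MvPolynomial (Fin (n + 2)) (CoeffRingM k n d M)) : Type u :=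
  Away (𝒜 (CoeffRingM k n d M)) g

/-- Homogeneous localizations at equal elements are isomorphic (transport). [cite: Hartshorne1977, II Prop. 2.5] -/
def awayCongr {g g' : MvPolynomial (Fin (n + 2)) (CoeffRingM k n d M)} (h : g = g') :
    Away (𝒜 (CoeffRingM k n d M)) g ≃+* Away (𝒜 (CoeffRingM k n d M)) g' := by
  subst h
  exact RingEquiv.refl _

/-- Transport of the quotients `Γ(D₊(g)) ⧸ 𝓘(D₊(g))` along `g = g'`. [cite: Hartshorne1977, II Prop. 2.5] -/
def sectionsQuotCongr {g g' : MvPolynomial (Fin (n + 2)) (CoeffRingM k n d M)} (h : g = g')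
    (hg : g ∈ (𝒜 (CoeffRingM k n d M)) 1) :
    (Γ(projSp n (CoeffRingM k n d M),
        (ProjSubscheme.affineBasicOpen (𝒜 (CoeffRingM k n d M)) g hg one_pos :
          (projSp n (CoeffRingM k n d M)).Opens)) ⧸
      (idealSheafM k n d M).ideal (ProjSubscheme.affineBasicOpen (𝒜 (CoeffRingM k n d M)) g hg one_pos)) ≃+*
    (Γ(projSp n (CoeffRingM k n d M),
        (ProjSubscheme.affineBasicOpen (𝒜 (CoeffRingM k n d M)) g' (h ▸ hg) one_pos :
          (projSp n (CoeffRingM k n d M)).Opens)) ⧸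
      (idealSheafM k n d M).ideal
        (ProjSubscheme.affineBasicOpen (𝒜 (CoeffRingM k n d M)) g' (h ▸ hg) one_pos)) := by
  subst h
  exact RingEquiv.refl _

/-- The transport commutes with `awayToSection` and the quotient maps. [cite: Hartshorne1977, II Prop. 2.5] -/
theorem sectionsQuotCongr_mk_awayToSection {g g' : MvPolynomial (Fin (n + 2)) (CoeffRingM k n d M)}
    (h : g = g') (hg : g ∈ (𝒜 (CoeffRingM k n d M)) 1) (b : Away (𝒜 (CoeffRingM k n d M)) g) :
    sectionsQuotCongr k n d M h hg
        (Ideal.Quotient.mk _ (Proj.awayToSection (𝒜 (CoeffRingM k n d M)) g b)) =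
      Ideal.Quotient.mk _ (Proj.awayToSection (𝒜 (CoeffRingM k n d M)) g' (awayCongr k n d M h b)) := by
  subst h
  rfl

/-- The chart generators `x_{i.succAbove j} / g` of `(R_M[x]_g)₀` for `g` of degree one (for `g = xᵢ`
these are `ProjectiveSpace.chartGen`). [cite: Hartshorne1977, II Prop. 2.5] -/
def chartGen' (g : MvPolynomial (Fin (n + 2)) (CoeffRingM k n d M)) (hg : g ∈ (𝒜 (CoeffRingM k n d M)) 1)
    (j : Fin (n + 1)) : Away (𝒜 (CoeffRingM k n d M)) g :=
  Away.mk _ hg 1 (X (i.succAbove j)) (by simpa using ProjectiveSpace.X_mem (i.succAbove j))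

/-- Transport of the chart generators. [cite: Hartshorne1977, II Prop. 2.5] -/
theorem awayCongr_chartGen' {g g' : MvPolynomial (Fin (n + 2)) (CoeffRingM k n d M)} (h : g = g')
    (hg : g ∈ (𝒜 (CoeffRingM k n d M)) 1) (j : Fin (n + 1)) :
    awayCongr k n d M h (chartGen' k n d M i g hg j) = chartGen' k n d M i g' (h ▸ hg) j := by
  subst h
  rfl

/-- Transport of scalars. [cite: Hartshorne1977, II Prop. 2.5] -/
theorem awayCongr_algebraMap {g g' : MvPolynomial (Fin (n + 2)) (CoeffRingM k n d M)} (h : g = g')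
    (r : CoeffRingM k n d M) :
    awayCongr k n d M h ((algebraMap (CoeffRingM k n d M) (AwayM k n d M g) : _ →+* _) r) =
      (algebraMap (CoeffRingM k n d M) (AwayM k n d M g') : _ →+* _) r := by
  subst h
  rfl

/-- For `g = xᵢ` the generators are `ProjectiveSpace.chartGen` (`rfl`). [cite: Hartshorne1977, II Prop. 2.5] -/
theorem chartGen'_X (j : Fin (n + 1)) :
    chartGen' k n d M i (X i) (ProjectiveSpace.X_mem i) j = ProjectiveSpace.chartGen (CoeffRingM k n d M) i j :=
  rfl

/-- **The base change `k[x]_{(xᵢ)} → R_M[x]_{(xᵢ)}` on the chart generators**: `x_j/xᵢ ↦ x_j/xᵢ`.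
[cite: Hartshorne1977, II Prop. 2.5] -/
theorem awayMap_chartGen (j : Fin (n + 1)) :
    Away.map (ProjBaseChangeRing.mapGraded k (CoeffRingM k n d M) (Fin (n + 2))) (X i)
        (ProjectiveSpace.chartGen k i j) =
      chartGen' k n d M i (mapX k n d M i) (mapX_mem k n d M i) j := by
  rw [ProjectiveSpace.chartGen, Away.map_mk, chartGen']
  refine HomogeneousLocalization.val_injective _ ?_
  rw [Away.val_mk, Away.val_mk]
  exact congrArg (fun x => Localization.mk x _) (ProjBaseChangeRing.mapGraded_X k (CoeffRingM k n d M) _)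

/-- **The base change on scalars**: `c ↦ c`. [cite: Hartshorne1977, II Prop. 2.5] -/
theorem awayMap_algebraMap (c : k) :
    Away.map (ProjBaseChangeRing.mapGraded k (CoeffRingM k n d M) (Fin (n + 2))) (X i)
        ((algebraMap k (Away (𝒜 k) (X i)) : _ →+* _) c) =
      (algebraMap (CoeffRingM k n d M) (AwayM k n d M (mapX k n d M i)) : _ →+* _)
        (algebraMap k (CoeffRingM k n d M) c) := by
  refine HomogeneousLocalization.val_injective _ ?_
  rw [ProjBaseChangeRing.val_awayMap, ProjBaseChange.val_algebraMap, ProjBaseChange.val_algebraMap,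
    IsScalarTower.algebraMap_apply k (MvPolynomial (Fin (n + 2)) k)
      (Localization.Away (X i : MvPolynomial (Fin (n + 2)) k)),
    Localization.awayMap, IsLocalization.Away.map, IsLocalization.map_eq,
    IsScalarTower.algebraMap_apply (CoeffRingM k n d M)
      (MvPolynomial (Fin (n + 2)) (CoeffRingM k n d M)) (Localization.Away (mapX k n d M i))]
  congr 1
  rw [RingHom.coe_coe, ProjBaseChangeRing.mapGraded_apply, MvPolynomial.algebraMap_eq,
    MvPolynomial.algebraMap_eq, MvPolynomial.map_C]
  rfl

/-- **The base change through the chart isomorphisms** `k[y] ≅ k[x]_{(xᵢ)} → R_M[x]_{(xᵢ)} ≅ R_M[y]`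
(the middle arrow read at `xᵢ` via the transport) **is `MvPolynomial.map (k → R_M)`**: both are ring
maps out of `k[y]` agreeing on scalars and on the `yⱼ`. [cite: Hartshorne1977, II Prop. 2.5] -/
theorem awayCongr_awayMap_chartAlgEquiv_symm (p : MvPolynomial (Fin (n + 1)) k) :
    awayCongr k n d M (mapX_eq k n d M i)
        (Away.map (ProjBaseChangeRing.mapGraded k (CoeffRingM k n d M) (Fin (n + 2))) (X i)
          ((ProjectiveSpace.chartAlgEquiv k i).symm p)) =
      (ProjectiveSpace.chartAlgEquiv (CoeffRingM k n d M) i).symm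
        (MvPolynomial.map (algebraMap k (CoeffRingM k n d M)) p) := by
  let Φ : MvPolynomial (Fin (n + 1)) k →+* Away (𝒜 (CoeffRingM k n d M)) (X i) :=
    ((awayCongr k n d M (mapX_eq k n d M i)).toRingHom.comp
      (Away.map (ProjBaseChangeRing.mapGraded k (CoeffRingM k n d M) (Fin (n + 2))) (X i))).comp
      (ProjectiveSpace.chartAlgEquiv k i).symm.toRingEquiv.toRingHom
  let Ψ : MvPolynomial (Fin (n + 1)) k →+* Away (𝒜 (CoeffRingM k n d M)) (X i) :=
    (ProjectiveSpace.chartAlgEquiv (CoeffRingM k n d M) i).symm.toRingEquiv.toRingHom.comp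
      (MvPolynomial.map (algebraMap k (CoeffRingM k n d M)))
  suffices h : Φ = Ψ from RingHom.congr_fun h p
  refine MvPolynomial.ringHom_ext (fun c => ?_) fun j => ?_
  · change awayCongr k n d M (mapX_eq k n d M i) (Away.map _ (X i)
        ((ProjectiveSpace.chartAlgEquiv k i).symm (C c))) =
      (ProjectiveSpace.chartAlgEquiv (CoeffRingM k n d M) i).symm (MvPolynomial.map _ (C c))
    rw [MvPolynomial.map_C, ← MvPolynomial.algebraMap_eq, ← MvPolynomial.algebraMap_eq,
      AlgEquiv.commutes, AlgEquiv.commutes, awayMap_algebraMap, awayCongr_algebraMap]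
  · change awayCongr k n d M (mapX_eq k n d M i) (Away.map _ (X i)
        ((ProjectiveSpace.chartAlgEquiv k i).symm (X j))) =
      (ProjectiveSpace.chartAlgEquiv (CoeffRingM k n d M) i).symm (MvPolynomial.map _ (X j))
    rw [MvPolynomial.map_X, ProjectiveSpace.chartAlgEquiv_symm_X,
      ProjectiveSpace.chartAlgEquiv_symm_X, awayMap_chartGen, awayCongr_chartGen', chartGen'_X]

/-! #### The polynomial chart `Γ(W_M, q⁻¹D₊(xᵢ)) ≅ Γ(ℙⁿ⁺¹_k, D₊(xᵢ))[t₁, …, t_r]` -/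

open scoped Classical in
/-- The eliminated coefficient indices `{m ∈ M | m ≠ d eᵢ}` numbered by `Fin (|M| - 1)`. [cite: Hartshorne1977, II Prop. 2.5] -/
def elimIdxEquiv : {m : M // m ≠ purePower n d M hM i} ≃ Fin (Nat.card M - 1) :=
  Fintype.equivFinOfCardEq (by
    rw [Fintype.card_subtype_compl, Fintype.card_subtype_eq, Nat.card_eq_fintype_card])

/-- `k[y₀, …, yₙ] ≅ Γ(ℙⁿ⁺¹_k, D₊(xᵢ))` (chart isomorphism followed by Mathlib `Proj.basicOpenIsoAway`).
[cite: Hartshorne1977, II Prop. 2.5] -/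
def baseChartSectionsEquiv :
    MvPolynomial (Fin (n + 1)) k ≃+* Γ((projectiveSpace (n + 1) k).left, baseChart k n i) :=
  (ProjectiveSpace.chartAlgEquiv k i).symm.toRingEquiv.trans
    (Proj.basicOpenIsoAway (𝒜 k) (X i) (ProjectiveSpace.X_mem i) one_pos).commRingCatIsoToRingEquiv

/-- Unfolding `baseChartSectionsEquiv` (`rfl`). [cite: Hartshorne1977, II Prop. 2.5] -/
theorem baseChartSectionsEquiv_apply (p : MvPolynomial (Fin (n + 1)) k) :
    baseChartSectionsEquiv k n i p =
      Proj.awayToSection (𝒜 k) (X i) ((ProjectiveSpace.chartAlgEquiv k i).symm p) :=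
  rfl

open scoped Classical in
/-- **The polynomial chart of `W_M` over `D₊(xᵢ)`**:
`Γ(W_M, q⁻¹D₊(xᵢ)) ≅ Γ(D₊(xᵢ))/𝓘 ≅ k[a_m (m ≠ d eᵢ), y] ≅ (k[y])[a_m (m ≠ d eᵢ)] ≅ Γ(ℙⁿ⁺¹_k, D₊(xᵢ))[t₁, …, t_{|M|-1}]`
(Mathlib `IdealSheafData.subschemeObjIso`, the elimination `chartSectionsQuotEquivElimM` of
`MonomialLinearSystemIncidence`, `MvPolynomial.sumAlgEquiv`). [cite: Hartshorne1977, II Prop. 2.5 and Prop. 5.9] -/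
def chartPolyEquiv (hd : 0 < d) :
    Γ((incidenceOverM k n d M).left, (incidenceToProj k n d M).left ⁻¹ᵁ baseChart k n i) ≃+*
      MvPolynomial (Fin (Nat.card M - 1)) Γ((projectiveSpace (n + 1) k).left, baseChart k n i) :=
  ((((((idealSheafM k n d M).subschemeObjIso (mapChart k n d M i)).commRingCatIsoToRingEquiv.trans
    (sectionsQuotCongr k n d M (mapX_eq k n d M i) (mapX_mem k n d M i))).trans
    (chartSectionsQuotEquivElimM k n d M hM i hd)).trans
    (MvPolynomial.sumAlgEquiv k _ (Fin (n + 1))).toRingEquiv).trans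
    (MvPolynomial.renameEquiv (MvPolynomial (Fin (n + 1)) k) (elimIdxEquiv n d M hM i)).toRingEquiv).trans
    (MvPolynomial.mapEquiv (Fin (Nat.card M - 1)) (baseChartSectionsEquiv k n i))

/-- `q^*` on the chart sections of `ℙⁿ⁺¹_k`: `s/xᵢᵐ ↦ s/xᵢᵐ` read in `Γ(ℙⁿ⁺¹_{R_M}, D₊(xᵢ))` (Mathlib
`Proj.awayToSection_comp_appLE`). [cite: Hartshorne1977, II Prop. 2.5] -/
theorem projToBaseField_app_awayToSection (a : Away (𝒜 k) (X i)) :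
    (projToBaseField k n d M).app (baseChart k n i) (Proj.awayToSection (𝒜 k) (X i) a) =
      Proj.awayToSection (𝒜 (CoeffRingM k n d M)) (mapX k n d M i)
        (Away.map (ProjBaseChangeRing.mapGraded k (CoeffRingM k n d M) (Fin (n + 2))) (X i) a) := by
  have h := Proj.awayToSection_comp_appLE
    (ProjBaseChangeRing.mapGraded k (CoeffRingM k n d M) (Fin (n + 2)))
    (ProjBaseChangeRing.irrelevant_le_map k (CoeffRingM k n d M) (Fin (n + 2)))
    (ProjectiveSpace.X_mem i)
  rw [Scheme.Hom.app_eq_appLE]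
  exact CategoryTheory.congr_fun h a

/-- `W_M ↪ ℙⁿ⁺¹_{R_M}` on sections over the affine chart, through `Γ(W_M, ·) ≅ Γ(·)/𝓘`: the quotient map
(Mathlib `IdealSheafData.subschemeι_app`). [cite: Hartshorne1977, II Prop. 5.9] -/
theorem subschemeObjIso_incidenceιM_app
    (t : Γ(projSp n (CoeffRingM k n d M), (mapChart k n d M i : (projSp n (CoeffRingM k n d M)).Opens))) :
    ((idealSheafM k n d M).subschemeObjIso (mapChart k n d M i)).hom
        ((incidenceιM k n d M).app (mapChart k n d M i : (projSp n (CoeffRingM k n d M)).Opens) t) =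
      Ideal.Quotient.mk _ t := by
  rw [Scheme.IdealSheafData.subschemeι_app, ← CategoryTheory.comp_apply, Category.assoc, Iso.inv_hom_id,
    Category.comp_id]
  rfl

/-- Through `Γ(D₊(xᵢ))/𝓘 ≅ k[a_m (m ≠ d eᵢ), y]`, the class of `w/1` (`w ∈ (R_M[x]_{xᵢ})₀ ≅ R_M[y]`) is the
elimination map applied to `w`. [cite: Hartshorne1977, II Prop. 2.5] -/
theorem chartSectionsQuotEquivElimM_mk_awayToSection (hd : 0 < d) (w : ChartAlgM k n d M i) :
    chartSectionsQuotEquivElimM k n d M hM i hd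
        (Ideal.Quotient.mk _ (Proj.awayToSection (𝒜 (CoeffRingM k n d M)) (X i) w)) =
      elimHom k n d M hM i (ProjectiveSpace.chartAlgEquiv (CoeffRingM k n d M) i w) := by
  have hA : (chartSectionsQuotEquivM k n d M hM i hd).symm
      (Ideal.Quotient.mk _ (Proj.awayToSection (𝒜 (CoeffRingM k n d M)) (X i) w)) =
        Ideal.Quotient.mk _ w := by
    rw [RingEquiv.symm_apply_eq]
    rfl
  change elimEquiv k n d M hM i (chartQuotEquivM k n d M i ((chartSectionsQuotEquivM k n d M hM i hd).symm
    (Ideal.Quotient.mk _ (Proj.awayToSection (𝒜 (CoeffRingM k n d M)) (X i) w)))) = _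
  rw [hA]
  rfl

/-- The elimination map on a polynomial with constant coefficients: `yⱼ ↦ yⱼ`. [cite: Hartshorne1977, II Prop. 2.5] -/
theorem elimHom_map_algebraMap (p : MvPolynomial (Fin (n + 1)) k) :
    elimHom k n d M hM i (MvPolynomial.map (algebraMap k (CoeffRingM k n d M)) p) =
      MvPolynomial.rename Sum.inr p := by
  induction p using MvPolynomial.induction_on with
  | C c =>
    rw [MvPolynomial.map_C, elimHom_C, AlgHom.commutes, MvPolynomial.rename_C, MvPolynomial.algebraMap_eq]
  | add p q hp hq => rw [map_add, map_add, hp, hq, map_add]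
  | mul_X p j hp => rw [map_mul, MvPolynomial.map_X, map_mul, hp, elimHom_X, map_mul, MvPolynomial.rename_X]

/-- `k[a, y] ≅ (k[y])[a]` sends a polynomial in `y` alone to a constant. [cite: Hartshorne1977, II Prop. 2.5] -/
theorem sumAlgEquiv_rename_inr {σ τ : Type*} (p : MvPolynomial τ k) :
    MvPolynomial.sumAlgEquiv k σ τ (MvPolynomial.rename Sum.inr p) = MvPolynomial.C p := by
  induction p using MvPolynomial.induction_on with
  | C c => rw [MvPolynomial.rename_C, MvPolynomial.sumAlgEquiv_C_inl]
  | add p q hp hq => rw [map_add, map_add, hp, hq, map_add]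
  | mul_X p j hp => rw [map_mul, MvPolynomial.rename_X, map_mul, hp, MvPolynomial.sumAlgEquiv_X_inr, map_mul]

/-- **The polynomial chart is compatible with `q^*`**: it sends `q^* s` to the constant `s`.
[cite: Hartshorne1977, II Prop. 2.5] -/
theorem chartPolyEquiv_appLE (hd : 0 < d) (s : Γ((projectiveSpace (n + 1) k).left, baseChart k n i)) :
    chartPolyEquiv k n d M hM i hd ((incidenceToProj k n d M).left.appLE (baseChart k n i)
        ((incidenceToProj k n d M).left ⁻¹ᵁ baseChart k n i) le_rfl s) = MvPolynomial.C s := by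
  obtain ⟨p, rfl⟩ := (baseChartSectionsEquiv k n i).surjective s
  rw [← Scheme.Hom.app_eq_appLE]
  change MvPolynomial.mapEquiv _ (baseChartSectionsEquiv k n i)
    (MvPolynomial.renameEquiv (MvPolynomial (Fin (n + 1)) k) (elimIdxEquiv n d M hM i)
      (MvPolynomial.sumAlgEquiv k _ (Fin (n + 1))
        (chartSectionsQuotEquivElimM k n d M hM i hd
          (sectionsQuotCongr k n d M (mapX_eq k n d M i) (mapX_mem k n d M i)
            (((idealSheafM k n d M).subschemeObjIso (mapChart k n d M i)).hom
              ((incidenceιM k n d M).app (mapChart k n d M i : (projSp n (CoeffRingM k n d M)).Opens)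
                ((projToBaseField k n d M).app (baseChart k n i)
                  (Proj.awayToSection (𝒜 k) (X i) ((ProjectiveSpace.chartAlgEquiv k i).symm p))))))))) = _
  rw [projToBaseField_app_awayToSection]
  rw [subschemeObjIso_incidenceιM_app, sectionsQuotCongr_mk_awayToSection,
    awayCongr_awayMap_chartAlgEquiv_symm, chartSectionsQuotEquivElimM_mk_awayToSection,
    AlgEquiv.apply_symm_apply, elimHom_map_algebraMap, sumAlgEquiv_rename_inr]
  change MvPolynomial.map _ (MvPolynomial.rename _ (MvPolynomial.C p)) = _
  rw [MvPolynomial.rename_C, MvPolynomial.map_C]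
  rfl

end IncidenceCharts

/-! ### §3 Odd cohomology of `W_M(ℂ)` vanishes -/

section Complex

open Literature.AlgebraicGeometry.Motives.UniversalHypersurface

/-- **`Hʲ(W_M(ℂ); ℂ) = 0` for `j` odd** when `M` is base-point free and `d ≥ 1`: `W_M → ℙⁿ⁺¹` is
Zariski-locally (over the `D₊(xᵢ)`) the product with `𝔸^{|M|-1}`, so `W_M(ℂ) → ℙⁿ⁺¹(ℂ)` induces
isomorphisms on complex cohomology (Dold 1963 Thm. 6.3; the tree's
`bijective_complexBetti_map_of_isZariskiLocallyAffineProduct`), and `Hʲ(ℙⁿ⁺¹(ℂ); ℂ) = 0` for odd `j`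
(Hatcher Thm. 3.19, `subsingleton_complexBetti_projectiveSpace_of_odd`).
[cite: Dold1963, Thm. 6.3] [cite: HatcherAT2002, Thm. 3.19] -/
theorem subsingleton_complexBetti_incidenceOverM_of_odd (n d : ℕ) (M : Set (DegIndex n d))
    (hM : IsBasePointFree n d M) (hd : 0 < d) {j : ℕ} (hj : Odd j) :
    Subsingleton (complexBetti (incidenceOverM ℂ n d M) j) := by
  haveI := subsingleton_complexBetti_projectiveSpace_of_odd (n + 1) hj
  haveI : T2Space (ComplexPoints (projectiveSpace (n + 1) ℂ)) :=
    ComplexPoints.t2Space_of_isSmoothProjective (isSmoothProjective_projectiveSpace_holds ℂ (n + 1))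
  haveI : CompactSpace (ComplexPoints (projectiveSpace (n + 1) ℂ)) :=
    ComplexPoints.compactSpace_of_isSmoothProjective (isSmoothProjective_projectiveSpace_holds ℂ (n + 1))
  exact subsingleton_complexBetti_of_mvPolynomial_charts (incidenceToProj ℂ n d M) (Nat.card M - 1)
    (baseChart ℂ n) (exists_mem_baseChart ℂ n) (isAffineOpen_baseChart ℂ n)
    (isAffineOpen_incidenceToProj_preimage_baseChart ℂ n d M)
    (fun i => chartPolyEquiv ℂ n d M hM i hd) (fun i s => chartPolyEquiv_appLE ℂ n d M hM i hd s) j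

end Complex

end Literature.AlgebraicGeometry.HodgeTheory

end
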